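import Literature.Probability.Percolation.SeededExplorer
import HarnessLib

/-!
# The examined set of the seeded exploration is the least closed set (order independence)

Topic `Probability/Percolation`.  The seeded boundary-interface exploration (`SeededExplorer.lean`;
Schramm–Smirnov, Ann. Probab. 39 (2011), §4, proof of Prop. 4.1: "we start on the curve β and
explore all the potential crossings") probes, at each step, SOME eligible edge.  Its terminal
examined set does not depend on these choices: it is the least set of examinable edges with no
eligible edge (`Seeded.examined_eq_of_isLeast`), because eligibility is monotone —
an edge eligible for `Y ⊆ Y'` is examined-or-eligible for `Y'` (`𝒪`, `𝒟` grow with the examined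
set).  This intrinsic description is what transports the exploration along lattice symmetries
(sequel) and is the lattice form of "`Γ` is the union of the interfaces with an endpoint on `β`"
(a set defined without reference to any exploration order).

* `Seeded.IsClosedSet 𝔖 ω Y` — `Y ⊆ A` and no edge is eligible for `(Y, ω)`;
* `Seeded.isClosedSet_examined` — the examined set is closed (termination);
* `Seeded.examined_subset_of_isClosedSet` — and is contained in every closed set (induction along
  the run: the probed edge is eligible for the current set, hence lies in any closed superset);
* `Seeded.IsClosedSet.inter` — closed sets are stable under intersection;
* **`Seeded.examined_eq_of_isLeast`** — the examined set is THE least closed set.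

Everything is proved; no named fact is introduced.

## References

* O. Schramm, S. Smirnov, Ann. Probab. 39 (2011) 1768–1814, arXiv:1101.5820, §4. [SchrammSmirnov2011]
* J. van den Berg, P. Nolin, arXiv:1706.07338v3 (2020), §5.2 (explorations following cluster
  boundaries). [VandenbergNolin2020]
-/

noncomputable section

namespace Literature.Probability.Percolation

open LatticeModels Relation ProbeHistory
open scoped Classical

namespace Seeded

variable {𝔖 : Seeds} {ω : BondConfig (Site 2)}

/-- **Closed sets of the exploration**: examinable edge sets with no eligible edge.
[cite: SchrammSmirnov2011, §4, proof of Prop. 4.1 (Γ = the union of the interfaces from β)] -/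
def IsClosedSet (𝔖 : Seeds) (ω : BondConfig (Site 2)) (Y : Finset (Sym2 (Site 2))) : Prop :=
  Y ⊆ 𝔖.A ∧ ∀ e, ¬ Eligible 𝔖 Y ω e

/-- **Monotonicity of eligibility**: an edge eligible for `Y` is, for any `Y' ⊇ Y`, examined or
eligible. [folklore] -/
theorem mem_or_eligible_of_subset {Y Y' : Finset (Sym2 (Site 2))} (hYY' : Y ⊆ Y') {e : Sym2 (Site 2)}
    (he : Eligible 𝔖 Y ω e) : e ∈ Y' ∨ Eligible 𝔖 Y' ω e := by
  by_cases heY' : e ∈ Y'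
  · exact Or.inl heY'
  · obtain ⟨heA, -, ⟨v, hv, hO⟩, ⟨f, hf, hD⟩⟩ := he
    exact Or.inr ⟨heA, heY', ⟨v, hv, hO.mono hYY'⟩, ⟨f, hf, hD.mono hYY'⟩⟩

/-- The whole examinable set is closed. [folklore] -/
theorem isClosedSet_A : IsClosedSet 𝔖 ω 𝔖.A :=
  ⟨subset_rfl, fun _ he => he.2.1 he.1⟩

/-- **Closed sets are stable under intersection.** [folklore] -/
theorem IsClosedSet.inter {Y₁ Y₂ : Finset (Sym2 (Site 2))} (h₁ : IsClosedSet 𝔖 ω Y₁)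
    (h₂ : IsClosedSet 𝔖 ω Y₂) : IsClosedSet 𝔖 ω (Y₁ ∩ Y₂) := by
  refine ⟨(Finset.inter_subset_left).trans h₁.1, fun e he => ?_⟩
  have hne : e ∉ Y₁ ∩ Y₂ := he.2.1
  rcases mem_or_eligible_of_subset (Finset.inter_subset_left) he with h | h
  · rcases mem_or_eligible_of_subset (Finset.inter_subset_right) he with h' | h'
    · exact hne (Finset.mem_inter.2 ⟨h, h'⟩)
    · exact h₂.2 e h'
  · exact h₁.2 e h

/-- **The examined set is closed** (termination). [folklore] -/
theorem isClosedSet_examined (ω : BondConfig (Site 2)) : IsClosedSet 𝔖 ω (examined 𝔖 ω) :=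
  ⟨examined_subset ω, not_eligible_termTime 𝔖 ω⟩

/-- Along the run, the examined edges stay inside any closed set. [folklore] -/
theorem supp_hist_subset_of_isClosedSet {Y : Finset (Sym2 (Site 2))} (hY : IsClosedSet 𝔖 ω Y) (t : ℕ) :
    supp ((explorer 𝔖).hist t ω) ⊆ Y := by
  induction t with
  | zero => simp
  | succ t ih =>
    cases hD : (explorer 𝔖).next ((explorer 𝔖).hist t ω) with
    | none => rw [Explorer.supp_hist_succ_of_none _ hD]; exact ih
    | some D =>
      obtain ⟨e, rfl, he⟩ := exists_eq_singleton_of_next_hist 𝔖 ω hD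
      intro x hx
      rw [Explorer.mem_supp_hist_succ_iff_of_some _ hD, Finset.mem_singleton] at hx
      rcases hx with rfl | hx
      · exact (mem_or_eligible_of_subset ih he).elim id fun h => (hY.2 _ h).elim
      · exact ih hx

/-- **The examined set is contained in every closed set.** [cite: SchrammSmirnov2011, §4, proof of Prop. 4.1] -/
theorem examined_subset_of_isClosedSet {Y : Finset (Sym2 (Site 2))} (hY : IsClosedSet 𝔖 ω Y) :
    examined 𝔖 ω ⊆ Y :=
  supp_hist_subset_of_isClosedSet hY _

/-- **Characterisation of the examined set**: it is the least closed set.  In particular it does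
not depend on the order in which eligible edges are probed.
[cite: SchrammSmirnov2011, §4, proof of Prop. 4.1 (Γ is intrinsic)] -/
theorem examined_eq_of_isLeast {Y : Finset (Sym2 (Site 2))} (hY : IsClosedSet 𝔖 ω Y)
    (hleast : ∀ Y', IsClosedSet 𝔖 ω Y' → Y ⊆ Y') : examined 𝔖 ω = Y :=
  Finset.Subset.antisymm (examined_subset_of_isClosedSet hY) (hleast _ (isClosedSet_examined ω))

end Seeded

end Literature.Probability.Percolation
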